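import Summits.QuantumFields.BalabanUV.T4Continuum.Spine.NE1p.DressedWindowScheduleModWin

/-!
# T⁴ programme, spine estimate NE1′ (node O3b/H2) — WINDOW-FORMAT FLOORS: the located cost of the PER-STEP-WINDOW format in
# kernel numbers (what a «cutoff-free birth window» presupposes of the displayed per-step data)
# (NE1′ formalisation swarm, own-initiative supplier item S1f in the scope of rows S1 ∕ S1d ∕ S1e of `t4/formal/NE1p/LEAVES.md`;
# INTENT CLAIMS.log l.10208; X(S1d) INFO-2 of leaf-09-g2 l.9652 and X43 INFO-2 ∕ GAPS-T4 I-ne1pleaf07-4 of this seat made citable)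

Cell `pub-balaban`, sub-cell `t4`, BINDER-OWNERS row NE1′, formalisation swarm `b2b-balaban-t4-ne1p-formalise-*`, seat
`b2b-balaban-t4-ne1p-formalise-leaf-07` (gen 3).  ADDITIVE — imports leaf-04's `Spine/NE1p/DressedWindowScheduleModWin`
(`WindowScheduleModWin`, p213785; transitively row S1d's `WindowScheduleWin`, p213367) ONLY; modifies nothing; arithmetic over the
schedules' FIELDS and over the displayed binder SHAPE `hdefwk` of END-F-win ∕ END-F-swin — exactly as leaf-08's
`DressedRootWin.window_budget_floor` ∕ `budgetFactor_lower_bound` and leaf-04's `DressedTransportScheduled.floor_window_budget`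
quantified located finding LF-1 for the uniform-floor format.

WHY.  The per-step-window faces (END-F-win p213121, END-F-swin p213946, END-F′-mod-swin, the END-ALL faces S3g ∕ S3h) discharge the
(w3)⁺ nesting from a schedule whose gap is `ρw (k+1) + wc (k+1) [+ ϱ₁ k] + σ k ≤ ρw k`, with the chart ∕ slice window `wc`
ANTITONE in the ABSOLUTE step (`hwc_anti`, discharging END-F-win's ∕ END-F-swin's binder `hwk_anti` — the carried slices' windows
only shrink along a family's life) and the (I4′) guard read
as `hdefwk : defect b k′ k ≤ wc k` for EVERY generation `(b, k′)` alive at `k` (leaf-09-g2's X(S1d) INFO-2: an absolute-step guard,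
not implied by F-6's generation-relative `hrate : defect b k′ k ≤ c_δψ^{k−k′}`, which grants a newborn `c_δ`).  The cutoff-free
witnesses (`WindowScheduleWin.geometric`, `WindowScheduleModWin.geometric`) are honest: their windows shrink like `q^k`.  This file
states the converse bookkeeping: WHATEVER the schedule, antitonicity makes any `wc`-guarded datum present at a LATE step `K` cost
`K` times its size in birth window — so a birth window `R = ρw 0` that is cutoff-free PRESUPPOSES that every displayed defect,
every fluctuation radius and (full gap) every complex chart ∕ slice radius at step `K` is `O(R∕K)`, uniformly over generations;
and a cutoff-INDEPENDENT floor under any of them bounds the number of met steps a single schedule can serve.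
* §1 over `WindowScheduleWin` (row S1d): `wc_le_wc_of_le` (antitone), **`window_budget_of_wcFloor`** (`δ₀ ≤ wc K ⟹ ρw K + K·δ₀ ≤
  ρw 0`), `window_budget_of_fluctuation` (`δ₀ := 2σ K`), **`window_budget_of_defect`** (under the displayed `hdefwk`: `ρw K +
  K·defect b k′ K ≤ ρw 0` for EVERY generation alive at `K`), and the rates `wc_le_birthWindow_div` ∕ `σ_le_birthWindow_div` ∕
  **`defect_le_birthWindow_div`** (`… ≤ ρw 0 ∕ K`, resp. `∕ 2K`, given `0 ≤ ρw K`).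
* §2 over `WindowScheduleModWin` (leaf-04, the ASSEMBLED leaf's schedule): `ϱ₁` antitone (`ϱ₁_le_ϱ₁_of_le`),
  **`window_budget_mod`** (`ρw (K+1) + (K+1)·(wc (K+1) + ϱ₁ K) ≤ ρw 0`), **`chartRadius_lt_birthWindow_div`** (`ϱc K < ϱ₁ K ≤
  ρw 0 ∕ (K+1)`) and `sliceRadius_lt_birthWindow_div` (every live generation's slice radius after step `K` is `< ρw 0 ∕ (K+1)`: the
  Cauchy radii of the carried slices shrink at least harmonically in the absolute step).
* §3 ONE schedule at every cutoff (the pattern of `DressedStabilityOfWinSchedules` §3 ∕ S3h): **`cutoff_le_of_wcFloor`** ∕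
  **`cutoff_le_of_defectFloor`** (`0 < δ₀ ≤ datum at step K`, `0 ≤ ρw K` ⟹ `K ≤ ρw 0 ∕ δ₀`) and **`no_uniform_defectFloor`**: no
  positive floor under the displayed defects at the last step of every cutoff is compatible with one schedule serving all cutoffs;
  qualitative forms `wc_eventually_lt` ∕ `σ_eventually_lt` ∕ `ϱc_eventually_lt` (the per-step data drop below any positive level).
* §4 the explicit instance: along `WindowScheduleWin.geometric` the displayed `hdefwk` reads `defect b k′ K ≤ 2σ₀q^K`
  (`geometric_defect_le`); conversely the ABSOLUTE-step reading `defect ≤ c_δψ^k` of the (I4′) rate is served by `geometric` with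
  `q := ψ`, `2σ₀ ≥ c_δ` (`hdefwk_geometric_of_absoluteRate`, and `hδfwk_geometric_of_absoluteRate` for the fresh-pair defects of the
  assembled faces; `geometricMod_defect_le` ∕ `hdefwk_geometricMod_of_absoluteRate` ∕ `hδfwk_geometricMod_of_absoluteRate` along leaf-04's
  `WindowScheduleModWin.geometric`, the assembled face's witness) — the format's dichotomy in one line each.

PROPOSED LF-LEDGER WORDING (typer's call; recorded, not resolved here — the owner's §F∕§G frame question made quantitative):
«LF-3 (window-format floors): for the per-step-window faces, cutoff-free birth window `R` ⇔ the `wc`-guarded per-step data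
(displayed defects (I4′), fluctuation radii (w3)⁺; on the assembled face also `ϱ₁`∕`ϱc`) are `O(R∕K)` at step `K` uniformly over
generations; whether Bałaban's fresh-pair defects, fluctuation supports and chart radii decay so in the tree's finest-lattice
`Fld d R` currency is the instantiation question.»  NOT an objection: S1d ∕ S1e ∕ S2h ∕ S3g STAND (c4 — their conclusions are the
binder types verbatim); nothing here is a statement about Bałaban's windows ([Balaban1989LargeFieldI] p. 190, (1.27) p. 187:
printed TYPE only, not opened here).

HONEST FRAMING.  Rung (B)+1 bookkeeping on ONE finite four-torus of fixed physical size — NOT infinite volume, NOT a mass gap,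
NOT OS on ℝ⁴, NOT the Clay problem, NOT summit progress.  NE1′ is NOT PRINTED and NOT PROVED; [folklore] order arithmetic over
binder shapes, 0 sorry, 0 citations used as facts, no `def`, no `def … : Prop`; no wall binder ((w1), (w2-act) THE NUMBER, (w5),
F-6's rate) touched.  Spine PROVED 0∕9 unchanged.  HONEST DEPENDENCY: continuum YM on T⁴ ⇐ BetaPertH ∧ nine spine estimates
(0/9 proved); BetaPertH ⇐ (D1) ∧ (D4) ∧ CAP+tail; G-an2-4 gates asym, D1 and NE2/3/4.
-/

noncomputable section

namespace Summit.QuantumFields.BalabanUV.T4Continuum.NE1p.DressedWindowScheduleFloors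

open Finset
open scoped BigOperators
open Literature.MathematicalPhysics.QuantumFieldTheory.Balaban1983to89
open Summit.QuantumFields.BalabanUV.T4Continuum.NE1p.DressedWindowScheduleWin
open Summit.QuantumFields.BalabanUV.T4Continuum.NE1p.DressedWindowScheduleModWin

/-! ## §1 Per-step chart windows are antitone: a late floor is consumed once per met step -/

section Win

variable {r w : ℝ} (W : WindowScheduleWin r w)

/-- [arith] [folklore] Chart ∕ slice windows are ANTITONE in the absolute step (`hwc_anti` iterated): the window of a late step
bounds every earlier one from below. -/
theorem wc_le_wc_of_le {j k : ℕ} (h : j ≤ k) : W.wc k ≤ W.wc j := by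
  induction k with
  | zero =>
    rw [Nat.le_zero.mp h]
  | succ k ih =>
    rcases Nat.lt_or_eq_of_le h with hlt | rfl
    · exact (W.hwc_anti k).trans (ih (Nat.lt_succ_iff.mp hlt))
    · exact le_rfl

/-- **A LATE CHART-WINDOW FLOOR IS CONSUMED ONCE PER MET STEP** [arith]: if the chart ∕ slice window of step `K` is at least `δ₀`,
then so is every earlier one (antitone), and THE GAP `ρw (k+1) + wc (k+1) + σ k ≤ ρw k` with `0 < σ k` gives
`ρw K + K·δ₀ ≤ ρw 0` — the per-step format's analogue of `WindowSchedule.window_budget` (`K·w`) and of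
`DressedRootWin.window_budget_floor` (`K·(w + r_*)`), with the UNIFORM quantities replaced by whatever floor survives at the last
step. [folklore] -/
theorem window_budget_of_wcFloor {δ₀ : ℝ} (K : ℕ) (hδ : δ₀ ≤ W.wc K) : W.ρw K + K * δ₀ ≤ W.ρw 0 := by
  have hsum : ∑ k ∈ range K, (W.wc (k + 1) + W.σ k) ≤ W.ρw 0 - W.ρw K := W.consumption_le K
  have hterm : ∀ k ∈ range K, δ₀ ≤ W.wc (k + 1) + W.σ k := by
    intro k hk
    have hk' : k + 1 ≤ K := Nat.succ_le_of_lt (mem_range.mp hk)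
    linarith [wc_le_wc_of_le W hk', W.hσ k]
  have hK : (K : ℝ) * δ₀ ≤ ∑ k ∈ range K, (W.wc (k + 1) + W.σ k) := by
    calc (K : ℝ) * δ₀ = ∑ _k ∈ range K, δ₀ := by rw [sum_const, card_range, nsmul_eq_mul]
      _ ≤ ∑ k ∈ range K, (W.wc (k + 1) + W.σ k) := sum_le_sum hterm
  linarith

/-- **THE FLUCTUATION RADIUS OF A LATE STEP IS CONSUMED ONCE PER MET STEP** [arith]: `2σ K ≤ wc K` (`hσwc`), hence
`ρw K + K·(2σ K) ≤ ρw 0`. [folklore] -/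
theorem window_budget_of_fluctuation (K : ℕ) : W.ρw K + K * (2 * W.σ K) ≤ W.ρw 0 :=
  window_budget_of_wcFloor W K (W.hσwc K)

/-- [arith] [folklore] Rate form: with a nonnegative window at step `K ≥ 1`, the chart ∕ slice window there is at most
`ρw 0 ∕ K`. -/
theorem wc_le_birthWindow_div {K : ℕ} (hρK : 0 ≤ W.ρw K) (hK : 0 < K) : W.wc K ≤ W.ρw 0 / K := by
  have h := window_budget_of_wcFloor W K le_rfl
  have hK' : (0 : ℝ) < K := Nat.cast_pos.mpr hK
  rw [le_div_iff₀ hK']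
  linarith

/-- [arith] [folklore] Rate form for the fluctuation radius: `σ K ≤ ρw 0 ∕ (2K)` — along ANY per-step-window schedule with
nonnegative windows the (w3)⁺ fluctuation supports shrink at least harmonically in the absolute step. -/
theorem σ_le_birthWindow_div {K : ℕ} (hρK : 0 ≤ W.ρw K) (hK : 0 < K) : W.σ K ≤ W.ρw 0 / (2 * K) := by
  have h := window_budget_of_fluctuation W K
  have hK' : (0 : ℝ) < 2 * K := by positivity
  rw [le_div_iff₀ hK']
  linarith

variable {B : T4TermFormat.Booking}

/-- **A DISPLAYED DEFECT AT A LATE STEP IS CONSUMED ONCE PER MET STEP** [arith]: under END-F-win's ∕ END-F-swin's (I4′) guard in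
the schedule form `hdefwk : ∀ b k′ k, defect b k′ k ≤ wc k` (row S1d's `transportLeaf_win_of_schedule`, leaf-04's
`transportLeaf_swin_of_schedule`), the transverse defect of ANY generation `(b, k′)` at step `K` — a newborn's included — costs
`K` times its size: `ρw K + K·defect b k′ K ≤ ρw 0`.  F-6's displayed RATE `defect b k′ k ≤ c_δψ^{k−k′}` is relative to the
birth scale and does not provide this; it is a presupposition on the instantiated defects in the ABSOLUTE step. [folklore] -/
theorem window_budget_of_defect {defect : B.Birth → ℕ → ℕ → ℝ}
    (hdefwk : ∀ (_b : B.Birth) (_k' k : ℕ), defect _b _k' k ≤ W.wc k) (b : B.Birth) (k' K : ℕ) :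
    W.ρw K + K * defect b k' K ≤ W.ρw 0 :=
  window_budget_of_wcFloor W K (hdefwk b k' K)

/-- [arith] [folklore] Rate form: every displayed defect at step `K ≥ 1` is at most `ρw 0 ∕ K` (nonnegative window at `K`). -/
theorem defect_le_birthWindow_div {defect : B.Birth → ℕ → ℕ → ℝ}
    (hdefwk : ∀ (_b : B.Birth) (_k' k : ℕ), defect _b _k' k ≤ W.wc k) (b : B.Birth) (k' : ℕ) {K : ℕ}
    (hρK : 0 ≤ W.ρw K) (hK : 0 < K) : defect b k' K ≤ W.ρw 0 / K :=
  (hdefwk b k' K).trans (wc_le_birthWindow_div W hρK hK)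

end Win

/-! ## §2 The assembled leaf's schedule: complex margins and chart radii are consumed the same way -/

section ModWin

variable {r w : ℝ} (W : WindowScheduleModWin r w)

/-- [arith] [folklore] The margin radii are ANTITONE in the absolute step (`ϱ₁ (k+1) ≤ ϱc k < ϱ₁ k`). -/
theorem ϱ₁_le_ϱ₁_of_le {j k : ℕ} (h : j ≤ k) : W.ϱ₁ k ≤ W.ϱ₁ j := by
  induction k with
  | zero =>
    rw [Nat.le_zero.mp h]
  | succ k ih =>
    rcases Nat.lt_or_eq_of_le h with hlt | rfl
    · exact ((W.hϱ₁c k).trans (W.hϱc₁ k).le).trans (ih (Nat.lt_succ_iff.mp hlt))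
    · exact le_rfl

/-- **THE FULL GAP CONSUMES THE LATE CHART WINDOW AND THE LATE MARGIN RADIUS ONCE PER MET STEP** [arith]: from leaf-04's
`consumption_le'` (`Σ_{k≤K} (wc (k+1) + ϱ₁ k + σ k) ≤ ρw 0 − ρw (K+1)`), antitonicity of `wc` and `ϱ₁` and `0 < σ k`:
`ρw (K+1) + (K+1)·(wc (K+1) + ϱ₁ K) ≤ ρw 0`. [folklore] -/
theorem window_budget_mod (K : ℕ) : W.ρw (K + 1) + (K + 1) * (W.wc (K + 1) + W.ϱ₁ K) ≤ W.ρw 0 := by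
  have hsum := W.consumption_le' (K + 1)
  have hterm : ∀ k ∈ range (K + 1), W.wc (K + 1) + W.ϱ₁ K ≤ W.wc (k + 1) + W.ϱ₁ k + W.σ k := by
    intro k hk
    have hk : k ≤ K := Nat.lt_succ_iff.mp (mem_range.mp hk)
    linarith [wc_le_wc_of_le W.toWindowScheduleWin (Nat.succ_le_succ hk), ϱ₁_le_ϱ₁_of_le W hk, W.hσ k]
  have hK : ((K : ℝ) + 1) * (W.wc (K + 1) + W.ϱ₁ K) ≤ ∑ k ∈ range (K + 1), (W.wc (k + 1) + W.ϱ₁ k + W.σ k) := by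
    calc ((K : ℝ) + 1) * (W.wc (K + 1) + W.ϱ₁ K) = ∑ _k ∈ range (K + 1), (W.wc (K + 1) + W.ϱ₁ K) := by
          rw [sum_const, card_range, nsmul_eq_mul]; push_cast; ring
      _ ≤ ∑ k ∈ range (K + 1), (W.wc (k + 1) + W.ϱ₁ k + W.σ k) := sum_le_sum hterm
  linarith

/-- **THE COMPLEX CHART RADIUS SHRINKS AT LEAST HARMONICALLY IN THE ABSOLUTE STEP** [arith]: with a nonnegative window after
step `K`, `ϱc K < ϱ₁ K ≤ ρw 0 ∕ (K+1)` — on the assembled face ((w2-act) `hE` and the carried slices are read on these radii;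
the (w4) ratio `2σ∕ϱc` stays free because `σ` shrinks the same way, §1). [folklore] -/
theorem chartRadius_lt_birthWindow_div {K : ℕ} (hρK : 0 ≤ W.ρw (K + 1)) :
    W.ϱc K < W.ϱ₁ K ∧ W.ϱ₁ K ≤ W.ρw 0 / (K + 1) := by
  refine ⟨W.hϱc₁ K, ?_⟩
  have h := window_budget_mod W K
  have hK' : (0 : ℝ) < K + 1 := by positivity
  rw [le_div_iff₀ hK']
  nlinarith [(W.wc_pos (K + 1)).le]

/-- [arith] [folklore] Hence every live generation's SLICE RADIUS after step `K` (leaf-04's `sliceRadius k″ (K+1) = ϱc K` for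
`k″ ≤ K`) is below `ρw 0 ∕ (K+1)`: the Cauchy radii of the carried slices of the assembled leaf shrink at least harmonically. -/
theorem sliceRadius_lt_birthWindow_div {k'' K : ℕ} (hk : k'' ≤ K) (hρK : 0 ≤ W.ρw (K + 1)) :
    W.sliceRadius k'' (K + 1) < W.ρw 0 / (K + 1) := by
  rw [W.sliceRadius_step hk]
  obtain ⟨h1, h2⟩ := chartRadius_lt_birthWindow_div W hρK
  exact h1.trans_le h2

end ModWin

/-! ## §3 One schedule at every cutoff: a cutoff-independent floor bounds the number of met steps -/

section AllCutoffs

variable {r w : ℝ} (W : WindowScheduleWin r w)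

/-- **A FLOOR BOUNDS THE CUTOFF** [arith]: if one schedule's chart ∕ slice window at step `K` is at least `δ₀ > 0` and its window
there is nonnegative, then `K ≤ ρw 0 ∕ δ₀` — a single schedule serves a cutoff-independent floor only up to a bounded number of
met steps. [folklore] -/
theorem cutoff_le_of_wcFloor {δ₀ : ℝ} {K : ℕ} (hδ0 : 0 < δ₀) (hδ : δ₀ ≤ W.wc K) (hρK : 0 ≤ W.ρw K) :
    (K : ℝ) ≤ W.ρw 0 / δ₀ := by
  have h := window_budget_of_wcFloor W K hδ
  rw [le_div_iff₀ hδ0]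
  linarith

variable {B : T4TermFormat.Booking}

/-- **A DEFECT FLOOR BOUNDS THE CUTOFF** [arith]: under the displayed `hdefwk`, a defect `≥ δ₀ > 0` carried by some generation at
step `K` of a schedule with `0 ≤ ρw K` forces `K ≤ ρw 0 ∕ δ₀`. [folklore] -/
theorem cutoff_le_of_defectFloor {defect : B.Birth → ℕ → ℕ → ℝ}
    (hdefwk : ∀ (_b : B.Birth) (_k' k : ℕ), defect _b _k' k ≤ W.wc k) {δ₀ : ℝ} {b : B.Birth} {k' K : ℕ}
    (hδ0 : 0 < δ₀) (hδ : δ₀ ≤ defect b k' K) (hρK : 0 ≤ W.ρw K) : (K : ℝ) ≤ W.ρw 0 / δ₀ :=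
  cutoff_le_of_wcFloor W hδ0 (hδ.trans (hdefwk b k' K)) hρK

/-- **NO CUTOFF-INDEPENDENT DEFECT FLOOR UNDER ONE SCHEDULE FOR ALL CUTOFFS** [arith]: let ONE per-step-window schedule `W` with
nonnegative windows serve, at every cutoff `K`, bookings `Bk K` whose displayed defects satisfy `hdefwk` (the pattern of
`DressedStabilityOfWinSchedules` §3: the same `geometric` schedule at every `(p, K)`).  Then there is NO `δ₀ > 0` below some
generation's defect at the last step `K` of every cutoff — the displayed (I4′) defects must become small in the ABSOLUTE step,
uniformly in the cutoff.  (Contrapositive bookkeeping of `cutoff_le_of_defectFloor` and the Archimedean property; nothing about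
Bałaban's defects is asserted.) [folklore] -/
theorem no_uniform_defectFloor {Bk : ℕ → T4TermFormat.Booking} {defect : ∀ K, (Bk K).Birth → ℕ → ℕ → ℝ}
    (hρ : ∀ K, 0 ≤ W.ρw K) (hdefwk : ∀ K, ∀ (_b : (Bk K).Birth) (_k' k : ℕ), defect K _b _k' k ≤ W.wc k) {δ₀ : ℝ}
    (hδ0 : 0 < δ₀) : ¬ ∀ K, ∃ (b : (Bk K).Birth) (k' : ℕ), δ₀ ≤ defect K b k' K := by
  intro hfloor
  obtain ⟨K, hK⟩ := exists_nat_gt (W.ρw 0 / δ₀)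
  obtain ⟨b, k', hb⟩ := hfloor K
  exact absurd (cutoff_le_of_defectFloor W (hdefwk K) hδ0 hb (hρ K)) (not_le.mpr hK)

/-- **QUALITATIVE FORM — THE PER-STEP DATA BECOME ARBITRARILY SMALL** [arith]: along ANY per-step-window schedule whose
windows stay nonnegative, the chart ∕ slice windows — hence (by `hdefwk` ∕ `hδfwk` ∕ `hθwk`) every displayed defect and fluctuation
diameter they guard — drop below any `δ₀ > 0` at some step. [folklore] -/
theorem wc_eventually_lt (hρ : ∀ K, 0 ≤ W.ρw K) {δ₀ : ℝ} (hδ0 : 0 < δ₀) : ∃ K, W.wc K < δ₀ := by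
  obtain ⟨K, hK⟩ := exists_nat_gt (W.ρw 0 / δ₀)
  refine ⟨K, lt_of_not_ge fun h => ?_⟩
  exact absurd (cutoff_le_of_wcFloor W hδ0 h (hρ K)) (not_le.mpr hK)

/-- [arith] [folklore] The fluctuation radii of such a schedule drop below any `s₀ > 0` at some step (`2σ K ≤ wc K`). -/
theorem σ_eventually_lt (hρ : ∀ K, 0 ≤ W.ρw K) {s₀ : ℝ} (hs0 : 0 < s₀) : ∃ K, W.σ K < s₀ := by
  obtain ⟨K, hK⟩ := wc_eventually_lt W hρ hs0
  exact ⟨K, by linarith [W.hσwc K, W.hσ K]⟩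

end AllCutoffs

section AllCutoffsMod

variable {r w : ℝ} (W : WindowScheduleModWin r w)

/-- [arith] [folklore] On the assembled face (leaf-04's `WindowScheduleModWin`): the complex chart radii — the Cauchy radii of the
carried slices and of (w2-act) `hE` — drop below any `ρ₀ > 0` at some step. -/
theorem ϱc_eventually_lt (hρ : ∀ K, 0 ≤ W.ρw K) {ρ₀ : ℝ} (hρ0 : 0 < ρ₀) :
    ∃ K, W.ϱc K < ρ₀ := by
  obtain ⟨K, hK⟩ := exists_nat_gt (W.ρw 0 / ρ₀)
  refine ⟨K, ?_⟩
  obtain ⟨h1, h2⟩ := chartRadius_lt_birthWindow_div W (hρ (K + 1))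
  have hK1 : W.ρw 0 / ((K : ℝ) + 1) < ρ₀ := by
    rw [div_lt_iff₀ (by positivity)]
    rw [div_lt_iff₀ hρ0] at hK
    nlinarith [(hρ 0)]
  exact h1.trans_le (h2.trans hK1.le)

end AllCutoffsMod

/-! ## §4 The explicit instance: what the cutoff-free geometric witness asks of the displayed defects -/

section Geometric

variable {B : T4TermFormat.Booking}

/-- [decided toy] Along row S1d's cutoff-free witness `WindowScheduleWin.geometric` (`wc K = 2σ₀q^K`) the displayed guard `hdefwk`
READS: every generation's defect at step `K` — a newborn's included — is at most `2σ₀q^K`, i.e. decays geometrically in the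
ABSOLUTE step.  The witness is honest about this; the line makes it explicit next to F-6's relative rate `c_δψ^{K−k′}`. [folklore] -/
theorem geometric_defect_le {r w q σ₀ ϱ₀ ρinf : ℝ} (hq0 : 0 < q) (hq1 : q < 1) (hσ₀ : 0 < σ₀) (hσ₀w : 2 * σ₀ ≤ w)
    (hϱ₀ : 0 < ϱ₀) {defect : B.Birth → ℕ → ℕ → ℝ}
    (hdefwk : ∀ (_b : B.Birth) (_k' k : ℕ),
      defect _b _k' k ≤ (WindowScheduleWin.geometric r w q σ₀ ϱ₀ ρinf hq0 hq1 hσ₀ hσ₀w hϱ₀).wc k)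
    (b : B.Birth) (k' K : ℕ) : defect b k' K ≤ 2 * σ₀ * q ^ K :=
  hdefwk b k' K

/-- [decided toy] **CONVERSELY, THE ABSOLUTE-STEP READING OF THE (I4′) RATE IS SERVED**: if the displayed defects decay from
scale `0` — `defect b k′ k ≤ c_δ·ψ^k` for every generation (the toy towers' reading; NOT F-6's generation-relative `c_δψ^{k−k′}`) —
then `hdefwk` holds along `WindowScheduleWin.geometric` with ratio `q := ψ` and fluctuation scale `σ₀` as soon as `c_δ ≤ 2σ₀`
(`0 < ψ < 1`).  Together with `no_uniform_defectFloor` this is the dichotomy of the format: cutoff-free under the absolute-step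
reading, cutoff-bounded under any cutoff-independent newborn floor. [folklore] -/
theorem hdefwk_geometric_of_absoluteRate {r w ψ σ₀ ϱ₀ ρinf cδ : ℝ} (hψ0 : 0 < ψ) (hψ1 : ψ < 1) (hσ₀ : 0 < σ₀)
    (hσ₀w : 2 * σ₀ ≤ w) (hϱ₀ : 0 < ϱ₀) (hcδ : cδ ≤ 2 * σ₀) {defect : B.Birth → ℕ → ℕ → ℝ}
    (habs : ∀ (b : B.Birth) (k' k : ℕ), defect b k' k ≤ cδ * ψ ^ k) :
    ∀ (_b : B.Birth) (_k' k : ℕ),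
      defect _b _k' k ≤ (WindowScheduleWin.geometric r w ψ σ₀ ϱ₀ ρinf hψ0 hψ1 hσ₀ hσ₀w hϱ₀).wc k := by
  intro b k' k
  show defect b k' k ≤ 2 * σ₀ * ψ ^ k
  have hψk : 0 ≤ ψ ^ k := pow_nonneg hψ0.le k
  exact (habs b k' k).trans (mul_le_mul_of_nonneg_right hcδ hψk)

/-- [decided toy] The same for the FRESH-PAIR defects of the assembled faces (`hδfwk : ∀ b k, ∀ p ∈ Sg k b, δf b k p ≤ wk p.1 p.2 k`,
read `≤ wc k` under a step-indexed schedule): the absolute-step reading `δf b k p ≤ c_δ·ψ^k` is served by `geometric` with `q := ψ`,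
`c_δ ≤ 2σ₀` — whereas END-F′-mod(-s)win's displayed `hδf : δf b k p ≤ c_δψ^{k−p.2}` is relative to the PARTNER's birth scale. [folklore] -/
theorem hδfwk_geometric_of_absoluteRate {r w ψ σ₀ ϱ₀ ρinf cδ : ℝ} (hψ0 : 0 < ψ) (hψ1 : ψ < 1) (hσ₀ : 0 < σ₀)
    (hσ₀w : 2 * σ₀ ≤ w) (hϱ₀ : 0 < ϱ₀) (hcδ : cδ ≤ 2 * σ₀) {Sg : ℕ → B.Birth → Finset (B.Birth × ℕ)}
    {δf : B.Birth → ℕ → B.Birth × ℕ → ℝ} (habs : ∀ (b : B.Birth) (k : ℕ), ∀ p ∈ Sg k b, δf b k p ≤ cδ * ψ ^ k) :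
    ∀ (b : B.Birth) (k : ℕ), ∀ p ∈ Sg k b,
      δf b k p ≤ (WindowScheduleWin.geometric r w ψ σ₀ ϱ₀ ρinf hψ0 hψ1 hσ₀ hσ₀w hϱ₀).wc k := by
  intro b k p hp
  show δf b k p ≤ 2 * σ₀ * ψ ^ k
  exact (habs b k p hp).trans (mul_le_mul_of_nonneg_right hcδ (pow_nonneg hψ0.le k))

/-- [decided toy] The same three readings along the ASSEMBLED leaf's cutoff-free witness `WindowScheduleModWin.geometric` (leaf-04;
`wc K = 2σ₀q^K` as well): the displayed `hdefwk` of `transportLeaf_assembled_mod_swin_of_schedule` READS `defect b k′ K ≤ 2σ₀q^K`. [folklore] -/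
theorem geometricMod_defect_le {r w q σ₀ ϱ₀ ρinf : ℝ} (hq0 : 0 < q) (hq1 : q < 1) (hσ₀ : 0 < σ₀) (hσ₀w : 2 * σ₀ ≤ w)
    (hϱ₀ : 0 < ϱ₀) (hϱ₀r : ϱ₀ ≤ r) {defect : B.Birth → ℕ → ℕ → ℝ}
    (hdefwk : ∀ (_b : B.Birth) (_k' k : ℕ),
      defect _b _k' k ≤ (WindowScheduleModWin.geometric r w q σ₀ ϱ₀ ρinf hq0 hq1 hσ₀ hσ₀w hϱ₀ hϱ₀r).wc k)
    (b : B.Birth) (k' K : ℕ) : defect b k' K ≤ 2 * σ₀ * q ^ K :=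
  hdefwk b k' K

/-- [decided toy] Along `WindowScheduleModWin.geometric` with `q := ψ`: the absolute-step reading `defect ≤ c_δ·ψ^k` serves the assembled
face's `hdefwk` as soon as `c_δ ≤ 2σ₀`. [folklore] -/
theorem hdefwk_geometricMod_of_absoluteRate {r w ψ σ₀ ϱ₀ ρinf cδ : ℝ} (hψ0 : 0 < ψ) (hψ1 : ψ < 1) (hσ₀ : 0 < σ₀)
    (hσ₀w : 2 * σ₀ ≤ w) (hϱ₀ : 0 < ϱ₀) (hϱ₀r : ϱ₀ ≤ r) (hcδ : cδ ≤ 2 * σ₀) {defect : B.Birth → ℕ → ℕ → ℝ}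
    (habs : ∀ (b : B.Birth) (k' k : ℕ), defect b k' k ≤ cδ * ψ ^ k) :
    ∀ (_b : B.Birth) (_k' k : ℕ),
      defect _b _k' k ≤ (WindowScheduleModWin.geometric r w ψ σ₀ ϱ₀ ρinf hψ0 hψ1 hσ₀ hσ₀w hϱ₀ hϱ₀r).wc k := by
  intro b k' k
  show defect b k' k ≤ 2 * σ₀ * ψ ^ k
  exact (habs b k' k).trans (mul_le_mul_of_nonneg_right hcδ (pow_nonneg hψ0.le k))

/-- [decided toy] … and the assembled face's fresh-pair guard `hδfwk : ∀ b k, ∀ p ∈ Sg k b, δf b k p ≤ W.wc k` likewise. [folklore] -/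
theorem hδfwk_geometricMod_of_absoluteRate {r w ψ σ₀ ϱ₀ ρinf cδ : ℝ} (hψ0 : 0 < ψ) (hψ1 : ψ < 1) (hσ₀ : 0 < σ₀)
    (hσ₀w : 2 * σ₀ ≤ w) (hϱ₀ : 0 < ϱ₀) (hϱ₀r : ϱ₀ ≤ r) (hcδ : cδ ≤ 2 * σ₀) {Sg : ℕ → B.Birth → Finset (B.Birth × ℕ)}
    {δf : B.Birth → ℕ → B.Birth × ℕ → ℝ} (habs : ∀ (b : B.Birth) (k : ℕ), ∀ p ∈ Sg k b, δf b k p ≤ cδ * ψ ^ k) :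
    ∀ (b : B.Birth) (k : ℕ), ∀ p ∈ Sg k b,
      δf b k p ≤ (WindowScheduleModWin.geometric r w ψ σ₀ ϱ₀ ρinf hψ0 hψ1 hσ₀ hσ₀w hϱ₀ hϱ₀r).wc k := by
  intro b k p hp
  show δf b k p ≤ 2 * σ₀ * ψ ^ k
  exact (habs b k p hp).trans (mul_le_mul_of_nonneg_right hcδ (pow_nonneg hψ0.le k))

end Geometric

end Summit.QuantumFields.BalabanUV.T4Continuum.NE1p.DressedWindowScheduleFloors

end
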